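import Summits.SmoothPoincare4.SmoothPoincare4.Theses.InformationMetricHadamard
import Summits.SmoothPoincare4.SmoothPoincare4.Theorems.InformationMetricHadamardC0AhRecognitionStubGradientLikeFieldAux2
import Mathlib.Topology.MetricSpace.HausdorffDistance
import Mathlib.Analysis.Calculus.Deriv.MeanValue

/-!
# Line `core-distance-morse`, crux `InformationMetricHadamard.C0AhRecognition` (stmt-SmoothPoincare4-6015) — stub E1, helper 3: the Lyapunov property of a gradient-like field (Danskin + real induction)

Let `K ⊆ W` be compact, `f = d_G(·, K)`, and let `X` be a vector field which, at every point `z`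
with `f(z) ≥ a/2`, makes an angle with margin `μ` against every `η`-almost nearest point `k` of
`z` in `K`: `μ · d(z, k) ≤ −G((Ex z)⁻¹ k, X z)` (the vector `−(Ex z)⁻¹ k / d(z,k)` is the gradient
of `d_G(k, ·)` at `z`, helper 2). Then along every integral curve `γ` of `X` on `[t₁, t₂]` started
in `{f ≥ a}`, `f` grows at rate `≥ μ`: `f(γ t₁) + μ (t₂ − t₁) ≤ f(γ t₂)`.

Proof (Grove–Shiohama 1977, §1; Petersen 2016, §12.1, proof of Lemma 12.1.4): `f` itself is never
differentiated. For `t` in the inductive set and small `h > 0`, a nearest point `k_h` of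
`γ(t+h)` is `η`-almost nearest for every `γ s`, `s ∈ [t, t+h]` (continuity of `γ`, `f` is
`1`-Lipschitz), so `s ↦ d_G(k_h, γ s) − μ s` is nondecreasing on `[t, t+h]` (helper 2 + the
hypothesis + `monotoneOn_of_hasDerivWithinAt_nonneg`), and Danskin's one-sided bound
`f(γ(t+h)) − f(γ t) ≥ d(k_h, γ(t+h)) − d(k_h, γ t) ≥ μ h` follows; real induction
(`IsClosed.Icc_subset_of_forall_mem_nhdsWithin`) globalises.

* `helper_gradientLikeField_3` — the statement above.

Everything is proved (kind = proof); no definitions.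
-/

noncomputable section

-- the prescribed namespace `Summit.<P>.<Sub>.…` duplicates `SmoothPoincare4` (P = Sub)
set_option linter.dupNamespace false

open scoped Manifold ContDiff Topology ENNReal NNReal
open Set Function Bundle Filter

namespace Summit.SmoothPoincare4.SmoothPoincare4.Cruxes.C0AhRecognition.CoreDistanceMorse

open Literature.Geometry.Lorentzian (PseudoRiemannianMetric)

set_option maxHeartbeats 1600000 in
/-- **E1 helper 3 (Lyapunov growth of the core distance along a gradient-like field).** In the
polar package (`d_G(p, Ex p u) = |u|_{G_p}`, Gauss lemma, reversal), let `K` be compact,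
`f = ⨅_{k ∈ K} d_G(·, k)`, and let the field `X` satisfy, at every `z` with `f z ≥ a/2`, for every
`k ∈ K` with `d(z,k) ≤ f z + η`, the margin `μ · d(z,k) ≤ −G_z((Ex z)⁻¹ k, X z)`. Then for every
integral curve `γ` of `X` on `[t₁, t₂]` with `f(γ t₁) ≥ a`:
`f(γ t₁) + μ (t₂ − t₁) ≤ f(γ t₂)` (Danskin's one-sided bound for `f = min_k d_k` via helper 2,
then real induction). [cite: GroveShiohama1977, §1; Petersen2016, §12.1 Lemma 12.1.4] -/
theorem helper_gradientLikeField_3 :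
    ∀ (W : Type) [TopologicalSpace W] [T2Space W] [SecondCountableTopology W]
    [ChartedSpace (EuclideanSpace ℝ (Fin 5)) W] [IsManifold (𝓡 5) ∞ W]
    (G : Literature.Geometry.Lorentzian.PseudoRiemannianMetric (𝓡 5) ∞ (EuclideanSpace ℝ (Fin 5))
      (TangentSpace (𝓡 5) : W → Type _)) (hG : G.IsRiemannian)
    (Ex : W → (EuclideanSpace ℝ (Fin 5) ≃ₘ^∞⟮𝓡 5, 𝓡 5⟯ W)),
    (∀ (p : W) (u : EuclideanSpace ℝ (Fin 5)),
      G.edist hG p (Ex p u) = ENNReal.ofReal (Real.sqrt (G.val p u u))) →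
    (∀ (p : W) (u w : EuclideanSpace ℝ (Fin 5)),
      G.val (Ex p u) (mfderiv (𝓡 5) (𝓡 5) (Ex p) u u) (mfderiv (𝓡 5) (𝓡 5) (Ex p) u w) =
        G.val p u w) →
    (∀ (p : W) (u : EuclideanSpace ℝ (Fin 5)),
      (Ex (Ex p u)).symm p = -(mfderiv (𝓡 5) (𝓡 5) (Ex p) u u)) →
    ∀ (K : Set W), IsCompact K → ∀ (X : Π y : W, TangentSpace (𝓡 5) y) (a μ η : ℝ),
      0 < a → 0 < μ → 0 < η →
      (∀ z : W, ENNReal.ofReal (a / 2) ≤ ⨅ k ∈ K, G.edist hG z k → ∀ k ∈ K,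
        G.edist hG z k ≤ (⨅ k' ∈ K, G.edist hG z k') + ENNReal.ofReal η →
        μ * (G.edist hG z k).toReal ≤ -(G.val z ((Ex z).symm k) (X z))) →
      ∀ (γ : ℝ → W) (t₁ t₂ : ℝ), t₁ ≤ t₂ → IsMIntegralCurveOn γ X (Icc t₁ t₂) →
        ENNReal.ofReal a ≤ ⨅ k ∈ K, G.edist hG (γ t₁) k →
        (⨅ k ∈ K, G.edist hG (γ t₁) k) + ENNReal.ofReal (μ * (t₂ - t₁)) ≤
          ⨅ k ∈ K, G.edist hG (γ t₂) k := by
  intro W _ _ _ _ _ G hG Ex hpol hgauss hrev K hK X a μ η ha hμ hη hcon γ t₁ t₂ ht hγ hfa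
  -- empty core: `f ≡ ⊤`
  rcases K.eq_empty_or_nonempty with hKe | hKne
  · subst hKe
    simp
  -- the distance structure of `(W, G)` and `f = infEDist(·, K)`
  letI := G.riemannianBundle hG
  haveI := G.isContinuousRiemannianBundle hG
  haveI : LocallyCompactSpace W := ChartedSpace.locallyCompactSpace (EuclideanSpace ℝ (Fin 5)) W
  letI : PseudoEMetricSpace W := .ofRiemannianMetric (𝓡 5) W
  have hed : ∀ y z : W, G.edist hG y z = edist y z := fun _ _ ↦ rfl
  set f : W → ℝ≥0∞ := fun y ↦ ⨅ k ∈ K, G.edist hG y k with hf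
  have hfE : ∀ y : W, f y = Metric.infEDist y K := fun _ ↦ rfl
  -- all distances are finite (polar package), hence so is `f`
  have hfin : ∀ y z : W, edist y z ≠ ⊤ := by
    intro y z
    rw [← hed, ← (Ex y).apply_symm_apply z, hpol]
    exact ENNReal.ofReal_ne_top
  obtain ⟨k₀, hk₀⟩ := hKne
  have hffin : ∀ y : W, f y ≠ ⊤ := fun y ↦
    ne_top_of_le_ne_top (hfin y k₀) (by rw [hfE]; exact Metric.infEDist_le_edist_of_mem hk₀)
  -- `f` is `1`-Lipschitz
  have hflip : ∀ y z : W, f y ≤ f z + edist y z := fun y z ↦ by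
    rw [hfE, hfE]; exact Metric.infEDist_le_infEDist_add_edist
  -- real-valued versions
  set φ : ℝ → ℝ := fun t ↦ (f (γ t)).toReal with hφ
  have hφf : ∀ t, f (γ t) = ENNReal.ofReal (φ t) := fun t ↦ (ENNReal.ofReal_toReal (hffin _)).symm
  have hφnn : ∀ t, 0 ≤ φ t := fun t ↦ ENNReal.toReal_nonneg
  -- continuity of `γ` and of `φ` on `[t₁, t₂]`
  have hγc : ContinuousOn γ (Icc t₁ t₂) := hγ.continuousOn
  have hfc : Continuous f := by
    have : Continuous fun y : W ↦ Metric.infEDist y K := Metric.continuous_infEDist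
    exact this
  have hφc : ContinuousOn φ (Icc t₁ t₂) :=
    ENNReal.continuousOn_toReal.comp (hfc.comp_continuousOn hγc) fun t _ ↦ hffin _
  have hφa : a ≤ φ t₁ := by
    have h := hfa
    rw [show (⨅ k ∈ K, G.edist hG (γ t₁) k) = f (γ t₁) from rfl, hφf] at h
    exact (ENNReal.ofReal_le_ofReal_iff (hφnn _)).1 h
  -- conversions between `edist` and reals
  have htoR : ∀ {x : ℝ≥0∞} {r : ℝ}, x ≠ ⊤ → 0 ≤ r → (x ≤ ENNReal.ofReal r ↔ x.toReal ≤ r) :=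
    fun hx hr ↦ by rw [← ENNReal.ofReal_toReal hx, ENNReal.ofReal_le_ofReal_iff hr,
      ENNReal.toReal_ofReal ENNReal.toReal_nonneg]
  -- ### the inductive set `S = {t | φ t₁ + μ (t - t₁) ≤ φ t}` contains `[t₁, t₂]`
  set Sset : Set ℝ := {t | φ t₁ + μ * (t - t₁) ≤ φ t} with hS
  have hmain : Icc t₁ t₂ ⊆ Sset := by
    apply IsClosed.Icc_subset_of_forall_mem_nhdsWithin
    · -- `S ∩ [t₁, t₂]` is closed
      have hrew : Sset ∩ Icc t₁ t₂ =
          Icc t₁ t₂ ∩ (fun t ↦ φ t - (φ t₁ + μ * (t - t₁))) ⁻¹' Ici 0 := by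
        ext t
        simp only [hS, mem_inter_iff, mem_setOf_eq, mem_preimage, mem_Ici, sub_nonneg]
        tauto
      rw [hrew]
      refine ContinuousOn.preimage_isClosed_of_isClosed ?_ isClosed_Icc isClosed_Ici
      exact hφc.sub (continuousOn_const.add (continuousOn_const.mul
        (continuousOn_id.sub continuousOn_const)))
    · show φ t₁ + μ * (t₁ - t₁) ≤ φ t₁
      simp
    · rintro t ⟨htS, ht1, ht2⟩
      have hφt : a ≤ φ t := by
        have h1 : φ t₁ + μ * (t - t₁) ≤ φ t := htS
        nlinarith [hμ.le, ht1]
      -- continuity of `γ` at `t`: `γ s` is `η'/4`-close to `γ t` for `s ∈ [t, t + h₀]`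
      set η' : ℝ := min η a with hη'
      have hη'0 : 0 < η' := lt_min hη ha
      have hη'η : η' ≤ η := min_le_left _ _
      have hη'a : η' ≤ a := min_le_right _ _
      have hε : (0 : ℝ≥0∞) < ENNReal.ofReal (η' / 4) := ENNReal.ofReal_pos.2 (by linarith)
      have hct : ContinuousWithinAt γ (Icc t₁ t₂) t := hγc t ⟨ht1, ht2.le⟩
      have hpre := hct.preimage_mem_nhdsWithin (Metric.eball_mem_nhds (γ t) hε)
      obtain ⟨U, hU, hUsub⟩ := mem_nhdsWithin_iff_exists_mem_nhds_inter.1 hpre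
      obtain ⟨ρ, hρ, hball⟩ := Metric.mem_nhds_iff.1 hU
      set h₀ : ℝ := min (ρ / 2) (t₂ - t) with hh₀
      have hh₀0 : 0 < h₀ := lt_min (by linarith) (by linarith)
      have hh₀ρ : h₀ ≤ ρ / 2 := min_le_left _ _
      have hh₀t : h₀ ≤ t₂ - t := min_le_right _ _
      have hclose : ∀ s ∈ Icc t (t + h₀), edist (γ s) (γ t) < ENNReal.ofReal (η' / 4) := by
        intro s hs
        have hsI : s ∈ Icc t₁ t₂ := ⟨ht1.trans hs.1, by linarith [hs.2]⟩
        have hsU : s ∈ U := hball (by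
          rw [Metric.mem_ball, Real.dist_eq, abs_lt]
          constructor <;> linarith [hs.1, hs.2])
        exact hUsub ⟨hsU, hsI⟩
      -- ### the local growth `φ (t + h) ≥ φ t + μ h` for `0 < h ≤ h₀`
      have hstep : ∀ h ∈ Ioc (0 : ℝ) h₀, φ t + μ * h ≤ φ (t + h) := by
        intro h hh
        have hthI : Icc t (t + h) ⊆ Icc t₁ t₂ := Icc_subset_Icc ht1 (by linarith [hh.2])
        -- a nearest point `kh` of `z = γ (t + h)`
        obtain ⟨kh, hkhK, hkh⟩ := hK.exists_infEDist_eq_edist ⟨k₀, hk₀⟩ (γ (t + h))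
        have hfz : f (γ (t + h)) = edist (γ (t + h)) kh := hkh
        -- along `[t, t + h]`: `γ s` stays `η'/2`-close to `γ (t + h)`
        have hclose2 : ∀ s ∈ Icc t (t + h),
            edist (γ s) (γ (t + h)) < ENNReal.ofReal (η' / 2) := by
          intro s hs
          have h1 := hclose s ⟨hs.1, hs.2.trans (by linarith [hh.2])⟩
          have h2 := hclose (t + h) ⟨by linarith [hh.1], by linarith [hh.2]⟩
          calc edist (γ s) (γ (t + h)) ≤ edist (γ s) (γ t) + edist (γ t) (γ (t + h)) :=
                edist_triangle _ _ _
            _ < ENNReal.ofReal (η' / 4) + ENNReal.ofReal (η' / 4) := by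
                rw [edist_comm (γ t)]
                exact ENNReal.add_lt_add h1 h2
            _ = ENNReal.ofReal (η' / 2) := by
                rw [← ENNReal.ofReal_add (by linarith) (by linarith)]; ring_nf
        -- (A) `f (γ s) ≥ a/2` on `[t, t + h]`
        have hA : ∀ s ∈ Icc t (t + h), ENNReal.ofReal (a / 2) ≤ f (γ s) := by
          intro s hs
          have h1 := hclose s ⟨hs.1, hs.2.trans (by linarith [hh.2])⟩
          have h2 : f (γ t) ≤ f (γ s) + edist (γ t) (γ s) := hflip _ _
          have h3 : (edist (γ t) (γ s)).toReal < η' / 4 := by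
            rw [edist_comm] at h1
            have := (ENNReal.toReal_lt_toReal (hfin _ _) ENNReal.ofReal_ne_top).2 h1
            rwa [ENNReal.toReal_ofReal (by linarith)] at this
          have h4 : φ t ≤ φ s + (edist (γ t) (γ s)).toReal := by
            have := ENNReal.toReal_mono (ENNReal.add_ne_top.2 ⟨hffin _, hfin _ _⟩) h2
            rwa [ENNReal.toReal_add (hffin _) (hfin _ _)] at this
          rw [hφf]
          exact ENNReal.ofReal_le_ofReal (by linarith)
        -- (B) `kh` is `η`-almost nearest for every `γ s`, `s ∈ [t, t + h]`
        have hB : ∀ s ∈ Icc t (t + h), edist (γ s) kh ≤ f (γ s) + ENNReal.ofReal η := by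
          intro s hs
          have h1 := hclose2 s hs
          calc edist (γ s) kh ≤ edist (γ s) (γ (t + h)) + edist (γ (t + h)) kh :=
                edist_triangle _ _ _
            _ = edist (γ s) (γ (t + h)) + f (γ (t + h)) := by rw [hfz]
            _ ≤ edist (γ s) (γ (t + h)) + (f (γ s) + edist (γ (t + h)) (γ s)) :=
                add_le_add le_rfl (hflip _ _)
            _ ≤ ENNReal.ofReal (η' / 2) + (f (γ s) + ENNReal.ofReal (η' / 2)) := by
                apply add_le_add h1.le (add_le_add le_rfl _)
                rw [edist_comm]; exact h1.le
            _ = f (γ s) + ENNReal.ofReal η' := by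
                rw [add_comm, add_assoc, ← ENNReal.ofReal_add (by linarith) (by linarith)]
                ring_nf
            _ ≤ f (γ s) + ENNReal.ofReal η := add_le_add le_rfl (ENNReal.ofReal_le_ofReal hη'η)
        -- (C) `γ s ≠ kh` and `d s := d(kh, γ s) ≥ a/2`
        have hdpos : ∀ s ∈ Icc t (t + h), a / 2 ≤ (edist kh (γ s)).toReal := by
          intro s hs
          have h1 : f (γ s) ≤ edist (γ s) kh := by
            rw [hfE]; exact Metric.infEDist_le_edist_of_mem hkhK
          have h2 := (hA s hs).trans h1
          rw [edist_comm] at h2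
          exact (ENNReal.ofReal_le_iff_le_toReal (hfin kh (γ s))).1 h2
        have hC : ∀ s ∈ Icc t (t + h), γ s ≠ kh := by
          intro s hs heq
          have h1 := hdpos s hs
          rw [heq, edist_self, ENNReal.toReal_zero] at h1
          linarith
        -- (D) the derivative of `r ↦ d(kh, γ r)` within `[t₁, t₂]` is `≥ μ` on `[t, t + h]`
        have hD : ∀ s ∈ Icc t (t + h), HasDerivWithinAt (fun r ↦ (G.edist hG kh (γ r)).toReal)
            (-(G.val (γ s) ((Ex (γ s)).symm kh) (X (γ s))) / (G.edist hG kh (γ s)).toReal)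
            (Icc t₁ t₂) s ∧
            μ ≤ -(G.val (γ s) ((Ex (γ s)).symm kh) (X (γ s))) / (G.edist hG kh (γ s)).toReal := by
          intro s hs
          have hsI : s ∈ Icc t₁ t₂ := hthI hs
          refine ⟨helper_gradientLikeField_2 W G hG Ex hpol hgauss hrev kh γ (Icc t₁ t₂) s
            (X (γ s)) (hγ s hsI) (hC s hs), ?_⟩
          have hcs := hcon (γ s) (hA s hs) kh hkhK (hB s hs)
          have hd : 0 < (G.edist hG kh (γ s)).toReal := by
            rw [hed]; linarith [hdpos s hs]
          rw [le_div_iff₀ hd]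
          rw [hed, edist_comm, ← hed]
          exact hcs
        -- monotonicity of `g r = d(kh, γ r) - μ r` on `[t, t + h]`
        have hmono : MonotoneOn (fun r ↦ (G.edist hG kh (γ r)).toReal - r * μ) (Icc t (t + h)) := by
          refine monotoneOn_of_hasDerivWithinAt_nonneg (convex_Icc _ _)
            (f' := fun r ↦ -(G.val (γ r) ((Ex (γ r)).symm kh) (X (γ r))) /
              (G.edist hG kh (γ r)).toReal - 1 * μ) ?_ ?_ ?_
          · intro r hr
            exact ((hD r hr).1.continuousWithinAt.mono hthI).sub
              ((continuousWithinAt_id.mul continuousWithinAt_const))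
          · intro r hr
            rw [interior_Icc] at hr ⊢
            have hr' : r ∈ Icc t (t + h) := Ioo_subset_Icc_self hr
            exact ((hD r hr').1.mono ((Ioo_subset_Icc_self).trans hthI)).sub
              ((hasDerivWithinAt_id r _).mul_const μ)
          · intro r hr
            rw [interior_Icc] at hr
            have := (hD r (Ioo_subset_Icc_self hr)).2
            linarith
        have hg := hmono ⟨le_rfl, by linarith [hh.1]⟩ ⟨by linarith [hh.1], le_rfl⟩
          (by linarith [hh.1])
        -- Danskin: `φ (t + h) - φ t ≥ d(kh, γ (t + h)) - d(kh, γ t)`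
        have hφth : φ (t + h) = (G.edist hG kh (γ (t + h))).toReal := by
          show (f (γ (t + h))).toReal = _
          rw [hfz, hed, edist_comm]
        have hφt' : φ t ≤ (G.edist hG kh (γ t)).toReal := by
          have h1 : f (γ t) ≤ edist (γ t) kh := by
            rw [hfE]; exact Metric.infEDist_le_edist_of_mem hkhK
          rw [hed, edist_comm]
          exact ENNReal.toReal_mono (hfin _ _) h1
        have hg' : (G.edist hG kh (γ t)).toReal - t * μ ≤
            (G.edist hG kh (γ (t + h))).toReal - (t + h) * μ := hg
        rw [hφth]
        nlinarith [hg', hφt']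
      -- ### hence `S ∈ 𝓝[>] t`
      have hsub : Ioc t (t + h₀) ⊆ Sset := by
        intro s hs
        have h1 := hstep (s - t) ⟨by linarith [hs.1], by linarith [hs.2]⟩
        have h2 : φ t₁ + μ * (t - t₁) ≤ φ t := htS
        show φ t₁ + μ * (s - t₁) ≤ φ s
        rw [show t + (s - t) = s by ring] at h1
        nlinarith [h1, h2]
      exact mem_of_superset (Ioc_mem_nhdsGT (by linarith)) hsub
  -- ### conclusion at `t₂`
  have h2 : φ t₁ + μ * (t₂ - t₁) ≤ φ t₂ := hmain ⟨ht, le_rfl⟩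
  show f (γ t₁) + ENNReal.ofReal (μ * (t₂ - t₁)) ≤ f (γ t₂)
  rw [hφf t₁, hφf t₂, ← ENNReal.ofReal_add (hφnn _) (by nlinarith [hμ.le, ht])]
  exact ENNReal.ofReal_le_ofReal h2

end Summit.SmoothPoincare4.SmoothPoincare4.Cruxes.C0AhRecognition.CoreDistanceMorse

end
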